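import Summits.Parity.GeneralizedHardyLittlewood.Theses.HullDial
import HarnessLib

/-!
# Crux `HullPairsMass` (stmt-Parity-13092, route `HullDial`, rank 4) — birth skeleton (BC3)

`Lines/birth.lean` (planner-skel-stmt-Parity-13092-0, 2026-08-17): the ENVELOPE → RELATIVE HARDY–LITTLEWOOD skeleton
of the mass crux M of route HullDial. Four named stubs and the kernel-checked composition
`HullPairsMass_of : stub₁ → stub₂ → stub₃ → stub₄ → HullPairsMass` (hypotheses = the name-keyed aliases
`__Registered.stub_*`, textually the stub signatures; conclusion = the route decl
`Summit.Parity.GeneralizedHardyLittlewood.Theses.HullDial.HullPairsMass` BY NAME; `sorry` only inside the four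
`stub_*`; hypothesis-free `HullPairsMass_skeleton` at the end). All statement text is generated from ONE source
(planner folder `gen_birth.py`); the let-prefixes are the crux's own, verbatim (`crux_unfold` below is `Iff.rfl`).

## The crux (verbatim `…Theses.HullDial.HullPairsMass`)

For `k ≥ 8`, `h ≥ 1` even, `ε > 0`, all large `x` and every prime `ℓ ≤ (log x)^8` with `k ∣ ℓ − 1`, `h < ℓ`:
`|x·X(x) − SN·Ncount(x)²| ≤ ε·Ncount(x)²`, where `res ℓ k u` ⇔ `u` is a NON-ZERO `k`-th power mod `ℓ` (`u ∈ H`,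
`|H| = (ℓ−1)/k`), the HULL `N = {n : every prime factor of n lies in H}`, `X = #{n ≤ x : n, n+h ∈ N}`,
`Ncount = #{n ≤ x : n ∈ N}`, `SN = [#{u mod ℓ : u, u+h ∈ H}·ℓ/((ℓ−1)/k)²]·∏_{p ≤ ⌈√x⌉−1, p ≠ ℓ, p ∉ H}
(1 − ν_h(p)/p)(1 − 1/p)^{−2}`, `ν_h(p) = 1` if `p ∣ h` else `2` (Hardy–Littlewood for hull pairs, ratio form).

## The cut — why these four pieces

STRUCTURAL FACT the line exploits: hull membership is a LOCAL condition at the non-split primes —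
`n ∈ N ⇔ n` is coprime to every prime `p ∉ H` — and it forces `n mod ℓ ∈ H` (a product of non-zero `k`-th powers is
one). Hence `N ⊆ E_w := {n : (n, Q_w) = 1 ∧ n mod ℓ ∈ H}`, `Q_w = ∏_{p ≤ w, p ≠ ℓ, p ∉ H} p`, for EVERY `w`: the
`w`-SIFTED ENVELOPE, a union of residue classes modulo `ℓ·Q_w` whose pair statistics are an exact finite (CRT)
computation. With `X_w`, `N_w` the pair / single counts of `E_w` on `[1, x]` and `R_w(x) = x·X_w(x)/N_w(x)²` its
normalised pair ratio, the Hardy–Littlewood heuristic for `N` is precisely the statement that `N` sits inside `E_w`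
like a random subset of relative density `Ncount/N_w` as far as pairs at shift `h` go, once `w → ∞` (Green–Tao's
"W-trick" shape, at ONE shift — the binary case no uniformity norm controls).

* `stub_envelopeRatio` — TRUE, provable now (size M): for every fixed `w`, `R_w(x) → SN_w` (the crux's singular
  series truncated at `w`, same `ℓ`-factor) as `x → ∞`, uniformly in primes `ℓ ≤ (log x)^8` with `k ∣ ℓ−1`.
* `stub_singularTail` — TRUE, provable now (size S–M): `SN_w → SN` as `w → ∞`, uniformly in `ℓ` and large `x`
  (for `w > h` every tail factor is `1 − 1/(p−1)² ∈ (0, 1)`).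
* `stub_relativeUpper` — OPEN (the sharp upper half): `x·X ≤ (R_w + ε)·Ncount²` for `w ≥ w₀(ε)`, large `x`.
* `stub_relativeLower` — OPEN (the existence half): `x·X ≥ (R_w − ε)·Ncount²` likewise.

Composition (`HullPairsMass_of`, no sorry): `ε/3` — the `w₀`'s of the three `w`-quantified stubs, `w := max`, the
envelope ratio at that `w`; intersect the four eventualities in `x`; per admissible `ℓ`, `abs_combine` with
`N = Ncount² ≥ 0`.

No piece is the crux in costume: the relative halves are ONE-SIDED and carry NO singular series (each compares two
counting functions), the two scaffolds are theorems; (relativeUpper ∧ relativeLower) ⟺ crux only THROUGH the two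
scaffolds and an `ε/3` argument — the open content is relocated, undiluted, into the singular-series-free relative form.
BC3 probes (planner folder `bc/probe_stub_*.lean`, outputs `bc/probe_stub_*.json`): for each of the four stubs `S`,
`S → HullPairsMass` and `S → GeneralizedHardyLittlewood` by `first | exact? | simpa | aesop` FAIL, and separately by
`exact?` ("could not close the goal"), `simpa` ("assumption failed"), `aesop` ("failed to prove the goal after
exhaustive search"), `simpa [C]`, `(unfold C; simpa)` FAIL — 48/48.

## Milestones the stubs expose (for provers; not items)

* upper bound with a constant: `x·X ≤ C_κ·R_w·Ncount²` by the β / Selberg upper-bound sieve — sift `E_w`-pairs by the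
  non-split primes in `(w, x^{1/u}]`, dimension `κ = 2(1 − 1/k)`, trivial remainders because `E_w` is periodic
  (HalberstamRichert1974 Ch. 5 shape; tree `Literature.NumberTheory.Sieve.*` upper sieves), against a Wirsing/LSD lower
  bound for `Ncount` uniform in `ℓ ≤ (log x)^8` (Tenenbaum2015 II.5) — the constant `1 + ε` of `stub_relativeUpper` is
  the parity-sensitive part;
* lower bound of the right order: `x·X ≥ c·R_w·Ncount²` for some `c > 0` — an Indlekofer-type theorem (B-twins,
  Acta Arith. 26 (1974/75), order `x/log x` via `r(n)` and the half-dimensional sieve, special to `k = 2`); open for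
  `k ≥ 8` and already giving hull pairs of the conjectured order at every even shift.

## Disproof used / negatives / guards

No `Disproof.lean` exists for this crux (`ledger crux ls stmt-Parity-13092`: no workfiles before this file; no
`Theorems/HullPairsMass/Negative/`). Negatives index (`ledger negatives --problem Parity`, 3 entries: stmt-Parity-9541
convolution moment at level one, stmt-Parity-14832 TupleElliott, stmt-Parity-4218 rectangle Chowla): no stub is an
instance (none involves `Λ`, `λ`, affine-linear systems or multiplication-table rectangles). Every stub keeps the crux's
guards verbatim (`8 ≤ k`, `1 ≤ h`, `Even h`, `ℓ.Prime`, `ℓ ≤ (log x)^8`, `k ∣ ℓ − 1`, `h < ℓ`, `∀ᶠ x`); load-bearing: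
`k ∣ ℓ − 1` in `stub_envelopeRatio` (`|H| = (ℓ−1)/k` is typed into `SN`), `∀ᶠ x` in both scaffolds (period
`ℓ·Q_w ≤ (log x)^8·4^w = o(x)`; `⌈√x⌉ − 1 ≥ w`); `Even h` and `8 ≤ k` are carried verbatim but not used by the
two scaffolds (for odd `h` with `2 ∉ H` both sides of the crux vanish; the stubs make no claim outside the crux's range).

Barriers (route class low-dim-sieve / level-of-distribution / hull / class-averaging): `Literature.Barriers.Parity.
TrueComplexityBinary` and `.CircleMethodBinaryBarrier` bite on the two relative stubs exactly as on the crux (one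
shift = infinite true complexity; minor-arc `L²` mass ≍ Ncount ≫ Ncount²/x) — the skeleton does not claim to evade
them; it isolates them from the two provable scaffolds. `.SelbergParityBarrier`: the sieve gives the milestones above,
not the constants `1 ± ε`.

Sources: HardyLittlewood1923; Freiberg–Kurlberg–Rosenzweig arXiv:1701.01157 (Conj. 1.1, ratio form; consistency §2);
Indlekofer doi:10.4064/aa-26-2-207-212; GreenTao2010 (W-trick; Conj. 1.2); HalberstamRichert1974; IwaniecActaArith1980;
FriedlanderIwaniecOpera2010 §6; Tenenbaum2015 II.5 (Wirsing / Landau–Selberg–Delange for `Ncount`); Loughran–Matthiesen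
arXiv:1904.12845 (finite-complexity frobenian correlations — the envelope side).
-/

set_option linter.unusedVariables false

noncomputable section

namespace Summit.Parity.GeneralizedHardyLittlewood.Cruxes.HullPairsMass.Birth

open scoped BigOperators Topology Classical
open Filter

open Summit.Parity.GeneralizedHardyLittlewood.Theses.HullDial (HullPairsMass)

/-! ## The four registered stubs (statements fully unfolded over Mathlib; registered verbatim) -/

/-- **Stub 1 — `stub_envelopeRatio`: the sifted envelope has the truncated singular series as its
pair ratio** (TRUE; provable now; size M). For every `k ≥ 8`, even `h ≥ 1`, EVERY `w` and `ε > 0`, for all large `x`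
and every prime `ℓ ≤ (log x)^8` with `k ∣ ℓ − 1`, `h < ℓ`: `|x·X_w(x)/N_w(x)² − SN_w| ≤ ε`, where
`env ℓ k w n ⇔ (n, Q_w) = 1 ∧ n mod ℓ ∈ H`, `Q_w = ∏_{p ≤ w, p ≠ ℓ, p ∉ H} p`, `X_w = #{n ≤ x : env n ∧ env (n+h)}`,
`N_w = #{n ≤ x : env n}`, and `SN_w` is the crux's `SN` with `primorial (⌈√x⌉₊ − 1)` replaced by `primorial w`.
Proof sketch: `env` is periodic modulo `m = ℓ·Q_w` (`ℓ ∤ Q_w`); by CRT the good pair classes number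
`A = #{u mod ℓ : u, u+h ∈ H}·∏_{p ∣ Q_w}(p − ν_h(p))` and the good single classes `B = |H|·φ(Q_w)` with
`|H| = (ℓ−1)/k` (cyclic `(ℤ/ℓ)ˣ`, `k ∣ ℓ−1`); `X_w = qA + O(A)`, `N_w = qB + O(B)`, `x = qm + O(m)`, so
`x·X_w/N_w² = (A·m/B²)(1 + O(1/q))` with `A·m/B² = SN_w ≤ 2k·2^h` and `q ≥ x/m − 1`, `m ≤ (log x)^8·4^w = o(x)`
uniformly in `ℓ`. Leans on: Mathlib `ZMod.chineseRemainder`, `Nat.card_units_zmod`/`IsCyclic` power maps,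
`Nat.totient`, `primorial`, periodic counting on `Finset.Icc`. Sources: HalberstamRichert1974 Ch. 1 (sieve notation
`A_d = Xω(d)/d + r_d` for periodic sets); Loughran–Matthiesen arXiv:1904.12845 (finite complexity). -/
theorem stub_envelopeRatio :
    let res : ℕ → ℕ → ℕ → Prop := fun ℓ k u => ∃ v : ZMod ℓ, v ≠ 0 ∧ v ^ k = (u : ZMod ℓ);
    let env : ℕ → ℕ → ℕ → ℕ → Prop := fun ℓ k w n => Nat.Coprime n (∏ p ∈ (primorial w).primeFactors.filter (fun p => p ≠ ℓ ∧ ¬ res ℓ k p), p) ∧ res ℓ k n;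
    let Xw : ℕ → ℕ → ℕ → ℕ → ℝ → ℝ := fun ℓ k h w x => (((Finset.Icc 1 ⌊x⌋₊).filter (fun n => env ℓ k w n ∧ env ℓ k w (n + h))).card : ℝ);
    let Nw : ℕ → ℕ → ℕ → ℝ → ℝ := fun ℓ k w x => (((Finset.Icc 1 ⌊x⌋₊).filter (fun n => env ℓ k w n)).card : ℝ);
    let SNw : ℕ → ℕ → ℕ → ℕ → ℝ := fun ℓ k h w => (((Finset.range ℓ).filter (fun u => res ℓ k u ∧ res ℓ k (u + h))).card : ℝ) * (ℓ : ℝ) / (((ℓ : ℝ) - 1) / (k : ℝ)) ^ 2 * ∏ p ∈ (primorial w).primeFactors.filter (fun p => p ≠ ℓ ∧ ¬ res ℓ k p), (1 - (if p ∣ h then (1 : ℝ) else 2) / (p : ℝ)) / (1 - 1 / (p : ℝ)) ^ 2;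
    ∀ k : ℕ, 8 ≤ k → ∀ h : ℕ, 1 ≤ h → Even h → ∀ w : ℕ, ∀ ε : ℝ, 0 < ε → ∀ᶠ x : ℝ in Filter.atTop, ∀ ℓ : ℕ, ℓ.Prime → (ℓ : ℝ) ≤ Real.log x ^ 8 → k ∣ ℓ - 1 → h < ℓ → |x * Xw ℓ k h w x / Nw ℓ k w x ^ 2 - SNw ℓ k h w| ≤ ε := by
  sorry

/-- **Stub 2 — `stub_singularTail`: the truncated singular series converges to the crux's,
uniformly** (TRUE; provable now; size S–M). For every `k ≥ 8`, even `h ≥ 1` and `ε > 0` there is `w₀` such that for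
all `w ≥ w₀`, all large `x` and every prime `ℓ ≤ (log x)^8` with `k ∣ ℓ − 1`, `h < ℓ`: `|SN_w − SN| ≤ ε`.
Proof sketch: for `w > h` and `⌈√x⌉₊ − 1 ≥ w`, `SN = SN_w·T` with `T = ∏_{w < p ≤ ⌈√x⌉₊−1, p ≠ ℓ, p ∉ H}
(1 − 2/p)(1 − 1/p)^{−2} = ∏ (1 − 1/(p−1)²) ∈ [1 − Σ_{n ≥ w} n^{−2}, 1] ⊆ [1 − 1/(w−1), 1]` (Weierstrass product
inequality), and `0 ≤ SN_w ≤ [ℓ·|H|/|H|²]·∏_{p ∣ h} p/(p−1) ≤ 2k·2^h` uniformly in `ℓ`, `w`; take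
`w₀ = max (h + 1) (2 + ⌈2k·2^h/ε⌉)`. Leans on: Mathlib `Finset.prod_le_one`, `Finset.one_sub_sum_le_prod_one_sub`
-type inequalities (or induction), `Nat.primeFactors_primorial`-style membership (`Nat.Prime p ∧ p ≤ w`), `primorial`.
Sources: HardyLittlewood1923 (absolute convergence of 𝔖); Freiberg–Kurlberg–Rosenzweig arXiv:1701.01157 §2. -/
theorem stub_singularTail :
    let res : ℕ → ℕ → ℕ → Prop := fun ℓ k u => ∃ v : ZMod ℓ, v ≠ 0 ∧ v ^ k = (u : ZMod ℓ);
    let SN : ℕ → ℕ → ℕ → ℝ → ℝ := fun ℓ k h x => (((Finset.range ℓ).filter (fun u => res ℓ k u ∧ res ℓ k (u + h))).card : ℝ) * (ℓ : ℝ) / (((ℓ : ℝ) - 1) / (k : ℝ)) ^ 2 * ∏ p ∈ (primorial (⌈Real.sqrt x⌉₊ - 1)).primeFactors.filter (fun p => p ≠ ℓ ∧ ¬ res ℓ k p), (1 - (if p ∣ h then (1 : ℝ) else 2) / (p : ℝ)) / (1 - 1 / (p : ℝ)) ^ 2;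
    let SNw : ℕ → ℕ → ℕ → ℕ → ℝ := fun ℓ k h w => (((Finset.range ℓ).filter (fun u => res ℓ k u ∧ res ℓ k (u + h))).card : ℝ) * (ℓ : ℝ) / (((ℓ : ℝ) - 1) / (k : ℝ)) ^ 2 * ∏ p ∈ (primorial w).primeFactors.filter (fun p => p ≠ ℓ ∧ ¬ res ℓ k p), (1 - (if p ∣ h then (1 : ℝ) else 2) / (p : ℝ)) / (1 - 1 / (p : ℝ)) ^ 2;
    ∀ k : ℕ, 8 ≤ k → ∀ h : ℕ, 1 ≤ h → Even h → ∀ ε : ℝ, 0 < ε → ∃ w₀ : ℕ, ∀ w : ℕ, w₀ ≤ w → ∀ᶠ x : ℝ in Filter.atTop, ∀ ℓ : ℕ, ℓ.Prime → (ℓ : ℝ) ≤ Real.log x ^ 8 → k ∣ ℓ - 1 → h < ℓ → |SNw ℓ k h w - SN ℓ k h x| ≤ ε := by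
  sorry

/-- **Stub 3 — `stub_relativeUpper`: RELATIVE HARDY–LITTLEWOOD, UPPER HALF** (OPEN;
conjecture-grade; size L — one of the two halves where the crux lives). For every `k ≥ 8`, even `h ≥ 1` and `ε > 0`
there is `w₀` such that for all `w ≥ w₀`, all large `x` and every prime `ℓ ≤ (log x)^8` with `k ∣ ℓ − 1`, `h < ℓ`:
`x·X(x) − R_w(x)·Ncount(x)² ≤ ε·Ncount(x)²`, `R_w = x·X_w/N_w²` — hull pairs at shift `h` are asymptotically NO MORE
frequent than for a random subset of the envelope `E_w ⊇ N` of the same relative density. No singular series occurs.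
Why plausibly true: it follows from the crux and Stubs 1–2 (`ε/3`), i.e. it is implied by the Hardy–Littlewood
heuristic in Freiberg–Kurlberg–Rosenzweig ratio form; with a constant `C_κ` (`κ = 2(1−1/k)`) in place of `1 + ε`
it is within reach NOW of the β/Selberg upper-bound sieve (sift `E_w`-pairs by the non-split primes in `(w, x^{1/u}]`:
periodic envelope ⇒ trivial remainders) plus a Wirsing/LSD lower bound for `Ncount` uniform in `ℓ`. Why it might fail: only together with the crux (a secondary term of relative size `≫ 1` in `x·X/Ncount²`
uniformly in `ℓ ≤ (log x)^8`, e.g. an `ℓ`-dependent bias of `N` among the classes of `H` not captured by `E_w`);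
the constant `1` is parity-sensitive (`Literature.Barriers.Parity.SelbergParityBarrier`, `.TrueComplexityBinary`).
Sources: HardyLittlewood1923; arXiv:1701.01157 Conj. 1.1; HalberstamRichert1974 (Selberg Λ² upper bound);
GreenTao2010 (W-trick / relative pseudorandomness). -/
theorem stub_relativeUpper :
    let res : ℕ → ℕ → ℕ → Prop := fun ℓ k u => ∃ v : ZMod ℓ, v ≠ 0 ∧ v ^ k = (u : ZMod ℓ);
    let hull : ℕ → ℕ → ℕ → Prop := fun ℓ k n => ∀ p ∈ n.primeFactors, res ℓ k p;
    let X : ℕ → ℕ → ℕ → ℝ → ℝ := fun ℓ k h x => (((Finset.Icc 1 ⌊x⌋₊).filter (fun n => hull ℓ k n ∧ hull ℓ k (n + h))).card : ℝ);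
    let Ncount : ℕ → ℕ → ℝ → ℝ := fun ℓ k x => (((Finset.Icc 1 ⌊x⌋₊).filter (fun n => hull ℓ k n)).card : ℝ);
    let env : ℕ → ℕ → ℕ → ℕ → Prop := fun ℓ k w n => Nat.Coprime n (∏ p ∈ (primorial w).primeFactors.filter (fun p => p ≠ ℓ ∧ ¬ res ℓ k p), p) ∧ res ℓ k n;
    let Xw : ℕ → ℕ → ℕ → ℕ → ℝ → ℝ := fun ℓ k h w x => (((Finset.Icc 1 ⌊x⌋₊).filter (fun n => env ℓ k w n ∧ env ℓ k w (n + h))).card : ℝ);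
    let Nw : ℕ → ℕ → ℕ → ℝ → ℝ := fun ℓ k w x => (((Finset.Icc 1 ⌊x⌋₊).filter (fun n => env ℓ k w n)).card : ℝ);
    ∀ k : ℕ, 8 ≤ k → ∀ h : ℕ, 1 ≤ h → Even h → ∀ ε : ℝ, 0 < ε → ∃ w₀ : ℕ, ∀ w : ℕ, w₀ ≤ w → ∀ᶠ x : ℝ in Filter.atTop, ∀ ℓ : ℕ, ℓ.Prime → (ℓ : ℝ) ≤ Real.log x ^ 8 → k ∣ ℓ - 1 → h < ℓ → x * X ℓ k h x - x * Xw ℓ k h w x / Nw ℓ k w x ^ 2 * Ncount ℓ k x ^ 2 ≤ ε * Ncount ℓ k x ^ 2 := by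
  sorry

/-- **Stub 4 — `stub_relativeLower`: RELATIVE HARDY–LITTLEWOOD, LOWER HALF** (OPEN;
conjecture-grade; size L — the existence half). Same quantifiers as Stub 3 with the conclusion
`R_w(x)·Ncount(x)² − x·X(x) ≤ ε·Ncount(x)²`: hull pairs at shift `h` are asymptotically NO LESS frequent than the
envelope predicts. Why plausibly true: implied by the crux and Stubs 1–2; numerically testable exactly as the crux
(route CHEAPEST FALSIFIER (2a): `k = 8`, `x ≤ 10⁹`, `ℓ ∈ {17, 41, 73, 89, 97}`, compare `x·X/Ncount²` with `R_w`, which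
needs no singular series at all). Milestone: `≥ c·R_w·Ncount²` for some `c > 0` (Indlekofer-type order of magnitude,
doi:10.4064/aa-26-2-207-212 for B-twins via `r(n)`, special to `k = 2`) is open for `k ≥ 8`. Why it might fail: a
lower-order deficit of hull pairs relative to the envelope (Mertens-type global factor `< 1` missed by local
densities — the refuter's recorded worry for the crux) would show here first, one-sidedly.
Sources: HardyLittlewood1923; arXiv:1701.01157; doi:10.4064/aa-26-2-207-212; Tenenbaum2015 II.5. -/
theorem stub_relativeLower :
    let res : ℕ → ℕ → ℕ → Prop := fun ℓ k u => ∃ v : ZMod ℓ, v ≠ 0 ∧ v ^ k = (u : ZMod ℓ);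
    let hull : ℕ → ℕ → ℕ → Prop := fun ℓ k n => ∀ p ∈ n.primeFactors, res ℓ k p;
    let X : ℕ → ℕ → ℕ → ℝ → ℝ := fun ℓ k h x => (((Finset.Icc 1 ⌊x⌋₊).filter (fun n => hull ℓ k n ∧ hull ℓ k (n + h))).card : ℝ);
    let Ncount : ℕ → ℕ → ℝ → ℝ := fun ℓ k x => (((Finset.Icc 1 ⌊x⌋₊).filter (fun n => hull ℓ k n)).card : ℝ);
    let env : ℕ → ℕ → ℕ → ℕ → Prop := fun ℓ k w n => Nat.Coprime n (∏ p ∈ (primorial w).primeFactors.filter (fun p => p ≠ ℓ ∧ ¬ res ℓ k p), p) ∧ res ℓ k n;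
    let Xw : ℕ → ℕ → ℕ → ℕ → ℝ → ℝ := fun ℓ k h w x => (((Finset.Icc 1 ⌊x⌋₊).filter (fun n => env ℓ k w n ∧ env ℓ k w (n + h))).card : ℝ);
    let Nw : ℕ → ℕ → ℕ → ℝ → ℝ := fun ℓ k w x => (((Finset.Icc 1 ⌊x⌋₊).filter (fun n => env ℓ k w n)).card : ℝ);
    ∀ k : ℕ, 8 ≤ k → ∀ h : ℕ, 1 ≤ h → Even h → ∀ ε : ℝ, 0 < ε → ∃ w₀ : ℕ, ∀ w : ℕ, w₀ ≤ w → ∀ᶠ x : ℝ in Filter.atTop, ∀ ℓ : ℕ, ℓ.Prime → (ℓ : ℝ) ≤ Real.log x ^ 8 → k ∣ ℓ - 1 → h < ℓ → x * Xw ℓ k h w x / Nw ℓ k w x ^ 2 * Ncount ℓ k x ^ 2 - x * X ℓ k h x ≤ ε * Ncount ℓ k x ^ 2 := by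
  sorry


/-! ## Name-keyed aliases of the four stub statements — the hypotheses of `HullPairsMass_of`

The skeleton audit (`#h21_check_skeleton`, run by `ledger skeleton check`) admits a hypothesis of the composing theorem
only if its head constant is a registered obligation or is NAMED like a declared stub; `__Registered.stub_X` is the
statement of `stub_X` verbatim under the stub's short name (device of `Cruxes/KolmogorovBlowup/Lines/birth.lean`,
AnomalousDissipation). Each alias is an `abbrev`, definitionally (and textually) its stub's signature — generated from
the same source text. -/
namespace __Registered

/-- Alias of the statement of `stub_envelopeRatio` (envelope pair ratio → truncated singular series), keyed by the stub name. -/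
abbrev stub_envelopeRatio : Prop :=
  let res : ℕ → ℕ → ℕ → Prop := fun ℓ k u => ∃ v : ZMod ℓ, v ≠ 0 ∧ v ^ k = (u : ZMod ℓ);
  let env : ℕ → ℕ → ℕ → ℕ → Prop := fun ℓ k w n => Nat.Coprime n (∏ p ∈ (primorial w).primeFactors.filter (fun p => p ≠ ℓ ∧ ¬ res ℓ k p), p) ∧ res ℓ k n;
  let Xw : ℕ → ℕ → ℕ → ℕ → ℝ → ℝ := fun ℓ k h w x => (((Finset.Icc 1 ⌊x⌋₊).filter (fun n => env ℓ k w n ∧ env ℓ k w (n + h))).card : ℝ);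
  let Nw : ℕ → ℕ → ℕ → ℝ → ℝ := fun ℓ k w x => (((Finset.Icc 1 ⌊x⌋₊).filter (fun n => env ℓ k w n)).card : ℝ);
  let SNw : ℕ → ℕ → ℕ → ℕ → ℝ := fun ℓ k h w => (((Finset.range ℓ).filter (fun u => res ℓ k u ∧ res ℓ k (u + h))).card : ℝ) * (ℓ : ℝ) / (((ℓ : ℝ) - 1) / (k : ℝ)) ^ 2 * ∏ p ∈ (primorial w).primeFactors.filter (fun p => p ≠ ℓ ∧ ¬ res ℓ k p), (1 - (if p ∣ h then (1 : ℝ) else 2) / (p : ℝ)) / (1 - 1 / (p : ℝ)) ^ 2;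
  ∀ k : ℕ, 8 ≤ k → ∀ h : ℕ, 1 ≤ h → Even h → ∀ w : ℕ, ∀ ε : ℝ, 0 < ε → ∀ᶠ x : ℝ in Filter.atTop, ∀ ℓ : ℕ, ℓ.Prime → (ℓ : ℝ) ≤ Real.log x ^ 8 → k ∣ ℓ - 1 → h < ℓ → |x * Xw ℓ k h w x / Nw ℓ k w x ^ 2 - SNw ℓ k h w| ≤ ε

/-- Alias of the statement of `stub_singularTail` (truncated singular series → the crux's), keyed by the stub name. -/
abbrev stub_singularTail : Prop :=
  let res : ℕ → ℕ → ℕ → Prop := fun ℓ k u => ∃ v : ZMod ℓ, v ≠ 0 ∧ v ^ k = (u : ZMod ℓ);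
  let SN : ℕ → ℕ → ℕ → ℝ → ℝ := fun ℓ k h x => (((Finset.range ℓ).filter (fun u => res ℓ k u ∧ res ℓ k (u + h))).card : ℝ) * (ℓ : ℝ) / (((ℓ : ℝ) - 1) / (k : ℝ)) ^ 2 * ∏ p ∈ (primorial (⌈Real.sqrt x⌉₊ - 1)).primeFactors.filter (fun p => p ≠ ℓ ∧ ¬ res ℓ k p), (1 - (if p ∣ h then (1 : ℝ) else 2) / (p : ℝ)) / (1 - 1 / (p : ℝ)) ^ 2;
  let SNw : ℕ → ℕ → ℕ → ℕ → ℝ := fun ℓ k h w => (((Finset.range ℓ).filter (fun u => res ℓ k u ∧ res ℓ k (u + h))).card : ℝ) * (ℓ : ℝ) / (((ℓ : ℝ) - 1) / (k : ℝ)) ^ 2 * ∏ p ∈ (primorial w).primeFactors.filter (fun p => p ≠ ℓ ∧ ¬ res ℓ k p), (1 - (if p ∣ h then (1 : ℝ) else 2) / (p : ℝ)) / (1 - 1 / (p : ℝ)) ^ 2;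
  ∀ k : ℕ, 8 ≤ k → ∀ h : ℕ, 1 ≤ h → Even h → ∀ ε : ℝ, 0 < ε → ∃ w₀ : ℕ, ∀ w : ℕ, w₀ ≤ w → ∀ᶠ x : ℝ in Filter.atTop, ∀ ℓ : ℕ, ℓ.Prime → (ℓ : ℝ) ≤ Real.log x ^ 8 → k ∣ ℓ - 1 → h < ℓ → |SNw ℓ k h w - SN ℓ k h x| ≤ ε

/-- Alias of the statement of `stub_relativeUpper` (relative Hardy–Littlewood, upper half), keyed by the stub name. -/
abbrev stub_relativeUpper : Prop :=
  let res : ℕ → ℕ → ℕ → Prop := fun ℓ k u => ∃ v : ZMod ℓ, v ≠ 0 ∧ v ^ k = (u : ZMod ℓ);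
  let hull : ℕ → ℕ → ℕ → Prop := fun ℓ k n => ∀ p ∈ n.primeFactors, res ℓ k p;
  let X : ℕ → ℕ → ℕ → ℝ → ℝ := fun ℓ k h x => (((Finset.Icc 1 ⌊x⌋₊).filter (fun n => hull ℓ k n ∧ hull ℓ k (n + h))).card : ℝ);
  let Ncount : ℕ → ℕ → ℝ → ℝ := fun ℓ k x => (((Finset.Icc 1 ⌊x⌋₊).filter (fun n => hull ℓ k n)).card : ℝ);
  let env : ℕ → ℕ → ℕ → ℕ → Prop := fun ℓ k w n => Nat.Coprime n (∏ p ∈ (primorial w).primeFactors.filter (fun p => p ≠ ℓ ∧ ¬ res ℓ k p), p) ∧ res ℓ k n;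
  let Xw : ℕ → ℕ → ℕ → ℕ → ℝ → ℝ := fun ℓ k h w x => (((Finset.Icc 1 ⌊x⌋₊).filter (fun n => env ℓ k w n ∧ env ℓ k w (n + h))).card : ℝ);
  let Nw : ℕ → ℕ → ℕ → ℝ → ℝ := fun ℓ k w x => (((Finset.Icc 1 ⌊x⌋₊).filter (fun n => env ℓ k w n)).card : ℝ);
  ∀ k : ℕ, 8 ≤ k → ∀ h : ℕ, 1 ≤ h → Even h → ∀ ε : ℝ, 0 < ε → ∃ w₀ : ℕ, ∀ w : ℕ, w₀ ≤ w → ∀ᶠ x : ℝ in Filter.atTop, ∀ ℓ : ℕ, ℓ.Prime → (ℓ : ℝ) ≤ Real.log x ^ 8 → k ∣ ℓ - 1 → h < ℓ → x * X ℓ k h x - x * Xw ℓ k h w x / Nw ℓ k w x ^ 2 * Ncount ℓ k x ^ 2 ≤ ε * Ncount ℓ k x ^ 2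

/-- Alias of the statement of `stub_relativeLower` (relative Hardy–Littlewood, lower half), keyed by the stub name. -/
abbrev stub_relativeLower : Prop :=
  let res : ℕ → ℕ → ℕ → Prop := fun ℓ k u => ∃ v : ZMod ℓ, v ≠ 0 ∧ v ^ k = (u : ZMod ℓ);
  let hull : ℕ → ℕ → ℕ → Prop := fun ℓ k n => ∀ p ∈ n.primeFactors, res ℓ k p;
  let X : ℕ → ℕ → ℕ → ℝ → ℝ := fun ℓ k h x => (((Finset.Icc 1 ⌊x⌋₊).filter (fun n => hull ℓ k n ∧ hull ℓ k (n + h))).card : ℝ);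
  let Ncount : ℕ → ℕ → ℝ → ℝ := fun ℓ k x => (((Finset.Icc 1 ⌊x⌋₊).filter (fun n => hull ℓ k n)).card : ℝ);
  let env : ℕ → ℕ → ℕ → ℕ → Prop := fun ℓ k w n => Nat.Coprime n (∏ p ∈ (primorial w).primeFactors.filter (fun p => p ≠ ℓ ∧ ¬ res ℓ k p), p) ∧ res ℓ k n;
  let Xw : ℕ → ℕ → ℕ → ℕ → ℝ → ℝ := fun ℓ k h w x => (((Finset.Icc 1 ⌊x⌋₊).filter (fun n => env ℓ k w n ∧ env ℓ k w (n + h))).card : ℝ);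
  let Nw : ℕ → ℕ → ℕ → ℝ → ℝ := fun ℓ k w x => (((Finset.Icc 1 ⌊x⌋₊).filter (fun n => env ℓ k w n)).card : ℝ);
  ∀ k : ℕ, 8 ≤ k → ∀ h : ℕ, 1 ≤ h → Even h → ∀ ε : ℝ, 0 < ε → ∃ w₀ : ℕ, ∀ w : ℕ, w₀ ≤ w → ∀ᶠ x : ℝ in Filter.atTop, ∀ ℓ : ℕ, ℓ.Prime → (ℓ : ℝ) ≤ Real.log x ^ 8 → k ∣ ℓ - 1 → h < ℓ → x * Xw ℓ k h w x / Nw ℓ k w x ^ 2 * Ncount ℓ k x ^ 2 - x * X ℓ k h x ≤ ε * Ncount ℓ k x ^ 2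

end __Registered

/-! ## Sanity: the let-texts are the crux's own -/

/-- The crux unfolds, by `Iff.rfl`, to the statement spelled with exactly the lets used in the stubs (so every atom
`X ℓ k h x`, `Ncount ℓ k x`, `SN ℓ k h x` of the stubs is the crux's). [folklore] -/
theorem crux_unfold : HullPairsMass ↔
    (      let res : ℕ → ℕ → ℕ → Prop := fun ℓ k u => ∃ v : ZMod ℓ, v ≠ 0 ∧ v ^ k = (u : ZMod ℓ);
      let hull : ℕ → ℕ → ℕ → Prop := fun ℓ k n => ∀ p ∈ n.primeFactors, res ℓ k p;
      let X : ℕ → ℕ → ℕ → ℝ → ℝ := fun ℓ k h x => (((Finset.Icc 1 ⌊x⌋₊).filter (fun n => hull ℓ k n ∧ hull ℓ k (n + h))).card : ℝ);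
      let Ncount : ℕ → ℕ → ℝ → ℝ := fun ℓ k x => (((Finset.Icc 1 ⌊x⌋₊).filter (fun n => hull ℓ k n)).card : ℝ);
      let SN : ℕ → ℕ → ℕ → ℝ → ℝ := fun ℓ k h x => (((Finset.range ℓ).filter (fun u => res ℓ k u ∧ res ℓ k (u + h))).card : ℝ) * (ℓ : ℝ) / (((ℓ : ℝ) - 1) / (k : ℝ)) ^ 2 * ∏ p ∈ (primorial (⌈Real.sqrt x⌉₊ - 1)).primeFactors.filter (fun p => p ≠ ℓ ∧ ¬ res ℓ k p), (1 - (if p ∣ h then (1 : ℝ) else 2) / (p : ℝ)) / (1 - 1 / (p : ℝ)) ^ 2;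
      ∀ k : ℕ, 8 ≤ k → ∀ h : ℕ, 1 ≤ h → Even h → ∀ ε : ℝ, 0 < ε → ∀ᶠ x : ℝ in Filter.atTop, ∀ ℓ : ℕ, ℓ.Prime → (ℓ : ℝ) ≤ Real.log x ^ 8 → k ∣ ℓ - 1 → h < ℓ → |x * X ℓ k h x - SN ℓ k h x * Ncount ℓ k x ^ 2| ≤ ε * Ncount ℓ k x ^ 2) :=
  Iff.rfl

/-! ## Sorry-free infrastructure: the ε/3 bookkeeping of the composition -/

/-- Real-number bookkeeping of the composition: two one-sided relative bounds (`a` against `R·N`),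
the envelope ratio `R` within `e/3` of the truncated singular series `S`, and `S` within `e/3` of the
crux's singular series `T`, give `|a − T·N| ≤ e·N` when `N ≥ 0`. [folklore] -/
theorem abs_combine {a R S T N e : ℝ} (hN : 0 ≤ N) (hu : a - R * N ≤ e / 3 * N)
    (hl : R * N - a ≤ e / 3 * N) (h1 : |R - S| ≤ e / 3) (h2 : |S - T| ≤ e / 3) :
    |a - T * N| ≤ e * N := by
  obtain ⟨h1l, h1u⟩ := abs_le.1 h1
  obtain ⟨h2l, h2u⟩ := abs_le.1 h2
  have p1 : (R - S) * N ≤ e / 3 * N := mul_le_mul_of_nonneg_right h1u hN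
  have p2 : (S - R) * N ≤ e / 3 * N := mul_le_mul_of_nonneg_right (by linarith) hN
  have q1 : (S - T) * N ≤ e / 3 * N := mul_le_mul_of_nonneg_right h2u hN
  have q2 : (T - S) * N ≤ e / 3 * N := mul_le_mul_of_nonneg_right (by linarith) hN
  rw [abs_le]
  constructor <;> nlinarith [p1, p2, q1, q2, hu, hl]

/-- **Composition** (kernel-checked, no `sorry` of its own): the four stub statements (as the name-keyed
aliases `__Registered.stub_*`, textually the stub signatures) imply the crux
`Summit.Parity.GeneralizedHardyLittlewood.Theses.HullDial.HullPairsMass` BY NAME. Given `k, h, ε`: take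
`w₀`'s from the tail stub and the two relative stubs at `ε/3`, `w := max`, the envelope-ratio stub at this `w`
and `ε/3`; intersect the four `∀ᶠ x`; for each admissible `ℓ` combine by `abs_combine` with `N = Ncount²`. -/
theorem HullPairsMass_of :
    __Registered.stub_envelopeRatio → __Registered.stub_singularTail →
      __Registered.stub_relativeUpper → __Registered.stub_relativeLower → HullPairsMass := by
  intro H1 H2 H3 H4
  dsimp only [__Registered.stub_envelopeRatio, __Registered.stub_singularTail,
    __Registered.stub_relativeUpper, __Registered.stub_relativeLower] at H1 H2 H3 H4
  dsimp only [HullPairsMass]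
  intro k hk h hh he ε hε
  have hε3 : 0 < ε / 3 := by positivity
  obtain ⟨w₂, hw₂⟩ := H2 k hk h hh he (ε / 3) hε3
  obtain ⟨w₃, hw₃⟩ := H3 k hk h hh he (ε / 3) hε3
  obtain ⟨w₄, hw₄⟩ := H4 k hk h hh he (ε / 3) hε3
  have E1 := H1 k hk h hh he (max (max w₂ w₃) w₄) (ε / 3) hε3
  have E2 := hw₂ (max (max w₂ w₃) w₄) (le_trans (le_max_left _ _) (le_max_left _ _))
  have E3 := hw₃ (max (max w₂ w₃) w₄) (le_trans (le_max_right _ _) (le_max_left _ _))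
  have E4 := hw₄ (max (max w₂ w₃) w₄) (le_max_right _ _)
  filter_upwards [E1, E2, E3, E4] with x e1 e2 e3 e4
  intro ℓ hℓ hlog hdiv hlt
  exact abs_combine (sq_nonneg _) (e3 ℓ hℓ hlog hdiv hlt) (e4 ℓ hℓ hlog hdiv hlt) (e1 ℓ hℓ hlog hdiv hlt)
    (e2 ℓ hℓ hlog hdiv hlt)

/-- **The skeleton in its final shape**: the crux BY NAME from the four registered stubs through the
sorry-free composition `HullPairsMass_of`; it depends on `sorryAx` through the `stub_*` ONLY. -/
theorem HullPairsMass_skeleton : HullPairsMass :=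
  HullPairsMass_of stub_envelopeRatio stub_singularTail stub_relativeUpper stub_relativeLower

end Summit.Parity.GeneralizedHardyLittlewood.Cruxes.HullPairsMass.Birth

end
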